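import Mathlib

/-!
# `SystemLSDRealSegment` — negative-side support: the two engines

Generic analysis behind the standing disprover's load-bearing witnesses for the crux
`Summit.Parity.BatemanHorn.Theses.AlmostPrimeZeros.SystemLSDRealSegment` (stmt-Parity-11292), extracted from
`Cruxes/SystemLSDRealSegment/Disproof.lean` §1 so that provers, planners and ideators can import them:

* ENGINE 1 (divergence): a real sequence of the shape `x⁻¹ e^{k(1-y) log log x} S(x)` with a divisor-type lower
  bound `S(x) ≥ (x/2) log x - x` tends to `+∞` as soon as `k(y-1) < 1` (`tendsto_atTop_of_lower_envelope`), and a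
  real sequence tending to `+∞` has no complex limit (`not_tendsto_ofReal_of_tendsto_atTop`);
* ENGINE 2 (identity theorem): two functions holomorphic on `|z| < 2` agreeing at the real points of `(5/4, 7/4)`
  agree on the ball (`eqOn_ball_of_eqOn_segment`); so a real-segment law PINS `Λ` and in particular `Λ 0`;
* the normaliser `e^{k(1-y) log log x} → 0` (`k ≥ 1`, `y > 1`) and the constant-statistic limit
  (`tendsto_zero_of_const_sum`), the archimedean factor `e^{(y-1) log D} Γ(y)^{-k} ≠ 0`.
-/

open Filter Finset
open scoped Topology

namespace Summit.Parity.BatemanHorn.Theorems.SystemLSDRealSegment.Negative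

/-! ## Real sequences seen in `ℂ` -/

/-- The real part of an `ofReal`-valued limit. [folklore] -/
theorem tendsto_re_of_tendsto_ofReal {u : ℕ → ℝ} {L : ℂ} (h : Tendsto (fun x => ((u x : ℝ) : ℂ)) atTop (𝓝 L)) :
    Tendsto u atTop (𝓝 L.re) :=
  ((Complex.continuous_re.tendsto L).comp h).congr fun x => by simp

/-- An `ofReal`-valued sequence whose real form tends to `0` has limit `0`. [folklore] -/
theorem eq_zero_of_tendsto_ofReal {u : ℕ → ℝ} {L : ℂ} (h : Tendsto (fun x => ((u x : ℝ) : ℂ)) atTop (𝓝 L))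
    (h0 : Tendsto u atTop (𝓝 0)) : L = 0 := by
  have h1 := (Complex.continuous_ofReal.tendsto (0 : ℝ)).comp h0
  simpa using tendsto_nhds_unique h h1

/-- From a real limit to the complex one. [folklore] -/
theorem tendsto_ofReal_of_tendsto {u : ℕ → ℝ} {L : ℝ} (h : Tendsto u atTop (𝓝 L)) :
    Tendsto (fun x => ((u x : ℝ) : ℂ)) atTop (𝓝 (L : ℂ)) :=
  (Complex.continuous_ofReal.tendsto L).comp h

/-- ENGINE 1 (qualitative): a real sequence tending to `+∞` has no complex limit. [folklore] -/
theorem not_tendsto_ofReal_of_tendsto_atTop {u : ℕ → ℝ} (h0 : Tendsto u atTop atTop) (L : ℂ) :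
    ¬Tendsto (fun x => ((u x : ℝ) : ℂ)) atTop (𝓝 L) := fun h =>
  not_tendsto_atTop_of_tendsto_nhds (tendsto_re_of_tendsto_ofReal h) h0

/-! ## ENGINE 2: the identity theorem from the real segment `(5/4, 7/4)` -/

/-- Two functions holomorphic on `|z| < 2` that agree at the real points of `(5/4, 7/4)` agree on the whole ball
(the points `3/2 + 1/(n+8)` accumulate at `3/2`). Hence a real-segment limit law PINS `Λ` on `ball 0 2`, in
particular `Λ 0`: the clause `Λ 0 = batemanHornConst f` of the crux is a genuine constraint. [folklore] -/
theorem eqOn_ball_of_eqOn_segment {Λ₁ Λ₂ : ℂ → ℂ} (h₁ : DifferentiableOn ℂ Λ₁ (Metric.ball 0 2))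
    (h₂ : DifferentiableOn ℂ Λ₂ (Metric.ball 0 2)) (h : ∀ y : ℝ, 5 / 4 < y → y < 7 / 4 → Λ₁ y = Λ₂ y) :
    Set.EqOn Λ₁ Λ₂ (Metric.ball 0 2) := by
  have hA₁ : AnalyticOnNhd ℂ Λ₁ (Metric.ball 0 2) := h₁.analyticOnNhd Metric.isOpen_ball
  have hA₂ : AnalyticOnNhd ℂ Λ₂ (Metric.ball 0 2) := h₂.analyticOnNhd Metric.isOpen_ball
  have hpc : IsPreconnected (Metric.ball (0 : ℂ) 2) := (convex_ball 0 2).isPreconnected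
  have hz : (((3 : ℝ) / 2 : ℝ) : ℂ) ∈ Metric.ball (0 : ℂ) 2 := by
    rw [Metric.mem_ball, dist_zero_right, Complex.norm_real, Real.norm_eq_abs]
    rw [abs_of_pos (by norm_num)]
    norm_num
  refine hA₁.eqOn_of_preconnected_of_frequently_eq hA₂ hpc hz ?_
  set u : ℕ → ℝ := fun n => (3 : ℝ) / 2 + 1 / ((n : ℝ) + 8) with hu
  have hu_t : Tendsto (fun n : ℕ => ((u n : ℝ) : ℂ)) atTop (𝓝[≠] (((3 : ℝ) / 2 : ℝ) : ℂ)) := by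
    refine tendsto_nhdsWithin_iff.2 ⟨?_, Eventually.of_forall fun n => ?_⟩
    · have h1 : Tendsto (fun n : ℕ => 1 / ((n : ℝ) + 8)) atTop (𝓝 0) :=
        tendsto_const_nhds.div_atTop (tendsto_atTop_add_const_right _ _ tendsto_natCast_atTop_atTop)
      have h2 : Tendsto u atTop (𝓝 ((3 : ℝ) / 2)) := by
        simpa [hu] using (tendsto_const_nhds (x := (3 : ℝ) / 2)).add h1
      exact (Complex.continuous_ofReal.tendsto _).comp h2
    · simp only [Set.mem_compl_iff, Set.mem_singleton_iff]
      rw [Complex.ofReal_inj]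
      have : (0 : ℝ) < 1 / ((n : ℝ) + 8) := by positivity
      intro heq
      simp only [hu] at heq
      linarith
  refine hu_t.frequently (Eventually.of_forall fun n => h (u n) ?_ ?_).frequently
  · have : (0 : ℝ) < 1 / ((n : ℝ) + 8) := by positivity
    simp only [hu]; linarith
  · have : 1 / ((n : ℝ) + 8) ≤ 1 / 8 := by
      apply div_le_div_of_nonneg_left (by norm_num) (by norm_num)
      have : (0 : ℝ) ≤ n := Nat.cast_nonneg n
      linarith
    simp only [hu]; linarith

/-- In particular a `Λ` holomorphic on `|z| < 2` vanishing at the real points of `(5/4, 7/4)` has `Λ 0 = 0`.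
[folklore] -/
theorem apply_zero_eq_zero_of_vanish {Λ : ℂ → ℂ} (hΛ : DifferentiableOn ℂ Λ (Metric.ball 0 2))
    (h : ∀ y : ℝ, 5 / 4 < y → y < 7 / 4 → Λ y = 0) : Λ 0 = 0 :=
  eqOn_ball_of_eqOn_segment hΛ (differentiableOn_const (0 : ℂ)) h (Metric.mem_ball_self (by norm_num))

/-! ## Normaliser and envelope limits -/

/-- `log log x → +∞` along the naturals. [folklore] -/
theorem tendsto_loglog_atTop : Tendsto (fun x : ℕ => Real.log (Real.log x)) atTop atTop :=
  Real.tendsto_log_atTop.comp (Real.tendsto_log_atTop.comp tendsto_natCast_atTop_atTop)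

/-- The normaliser `e^{k(1-y) log log x}` tends to `0` for `k ≥ 1`, `y > 1`. [folklore] -/
theorem tendsto_normaliser_zero {k : ℕ} (hk : 1 ≤ k) {y : ℝ} (hy : 1 < y) :
    Tendsto (fun x : ℕ => Real.exp (k * (1 - y) * Real.log (Real.log x))) atTop (𝓝 0) := by
  refine Real.tendsto_exp_atBot.comp ?_
  have hneg : (k : ℝ) * (1 - y) < 0 :=
    mul_neg_of_pos_of_neg (by exact_mod_cast hk) (by linarith)
  exact Tendsto.const_mul_atTop_of_neg hneg tendsto_loglog_atTop

/-- CONSTANT STATISTIC: `x⁻¹ e^{k(1-y) log log x} ((x+1) c) → 0` (`k ≥ 1`, `y > 1`) — the normalised sum of a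
family whose statistic is constant (`-X`: every weight `y⁰`; `C 3`: every weight `y¹`). [folklore] -/
theorem tendsto_zero_of_const_sum {k : ℕ} (hk : 1 ≤ k) {y : ℝ} (hy : 1 < y) (c : ℝ) :
    Tendsto (fun x : ℕ => (x : ℝ)⁻¹ * Real.exp (k * (1 - y) * Real.log (Real.log x)) * ((x + 1) * c))
      atTop (𝓝 0) := by
  have hsucc : Tendsto (fun x : ℕ => (x : ℝ)⁻¹ * (x + 1)) atTop (𝓝 1) := by
    have h : Tendsto (fun x : ℕ => 1 + (x : ℝ)⁻¹) atTop (𝓝 1) := by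
      simpa using tendsto_const_nhds.add (tendsto_inv_atTop_nhds_zero_nat (𝕜 := ℝ))
    refine h.congr' ?_
    filter_upwards [eventually_ne_atTop 0] with x hx
    have : (x : ℝ) ≠ 0 := by exact_mod_cast hx
    field_simp
  have := ((hsucc.mul (tendsto_normaliser_zero hk hy)).mul_const c)
  simp only [mul_zero, zero_mul] at this
  exact this.congr fun x => by ring

/-- A real sequence eventually bounded below by `½ (log x)^b - 1` with `b > 0` tends to `+∞`. [folklore] -/
theorem tendsto_atTop_of_loglower {u : ℕ → ℝ} {b : ℝ} (hb : 0 < b)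
    (h : ∀ᶠ x : ℕ in atTop, 1 / 2 * Real.log x ^ b - 1 ≤ u x) : Tendsto u atTop atTop := by
  refine tendsto_atTop_mono' atTop h ?_
  have h1 : Tendsto (fun x : ℕ => Real.log x ^ b) atTop atTop :=
    (tendsto_rpow_atTop hb).comp (Real.tendsto_log_atTop.comp tendsto_natCast_atTop_atTop)
  exact tendsto_atTop_add_const_right _ (-1) (h1.const_mul_atTop (by norm_num : (0 : ℝ) < 1 / 2))

/-- ENGINE 1 (quantitative): a divisor-type lower bound `S(x) ≥ (x/2) log x - x` makes the normalised quantity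
`x⁻¹ e^{k(1-y) log log x} S(x) ≥ ½ (log x)^{1 - k(y-1)} - 1` diverge as soon as `k(y-1) < 1`. [folklore] -/
theorem tendsto_atTop_of_lower_envelope {k : ℕ} {y : ℝ} {S : ℕ → ℝ} (hy : 1 < y)
    (hky : (k : ℝ) * (y - 1) < 1) (hlow : ∀ x : ℕ, 3 ≤ x → (x : ℝ) / 2 * Real.log x - x ≤ S x) :
    Tendsto (fun x : ℕ => (x : ℝ)⁻¹ * Real.exp (k * (1 - y) * Real.log (Real.log x)) * S x) atTop atTop := by
  set a : ℝ := k * (1 - y) with ha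
  have ha0 : a ≤ 0 := by
    have : (0 : ℝ) ≤ k := Nat.cast_nonneg k
    rw [ha]; nlinarith
  have hb : 0 < a + 1 := by rw [ha]; linarith
  refine tendsto_atTop_of_loglower hb ?_
  filter_upwards [eventually_ge_atTop 3] with x hx
  have hx0 : (0 : ℝ) < x := by exact_mod_cast (show 0 < x by omega)
  have hlog : 1 < Real.log x := by
    rw [Real.lt_log_iff_exp_lt hx0]
    have := Real.exp_one_lt_d9
    have h3 : (3 : ℝ) ≤ x := by exact_mod_cast hx
    linarith
  have hlog0 : 0 < Real.log x := by linarith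
  have hexp : Real.exp (k * (1 - y) * Real.log (Real.log x)) = Real.log x ^ a := by
    rw [Real.rpow_def_of_pos hlog0, ha, mul_comm]
  have hS := hlow x hx
  have hpow_le : Real.log x ^ a ≤ 1 := Real.rpow_le_one_of_one_le_of_nonpos hlog.le ha0
  have hpow_pos : 0 < Real.log x ^ a := Real.rpow_pos_of_pos hlog0 a
  calc 1 / 2 * Real.log x ^ (a + 1) - 1
      ≤ 1 / 2 * Real.log x ^ (a + 1) - Real.log x ^ a := by linarith
    _ = Real.log x ^ a * ((x : ℝ)⁻¹ * ((x : ℝ) / 2 * Real.log x - x)) := by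
        rw [Real.rpow_add_one hlog0.ne']
        field_simp
    _ ≤ Real.log x ^ a * ((x : ℝ)⁻¹ * S x) := by gcongr
    _ = (x : ℝ)⁻¹ * Real.exp (k * (1 - y) * Real.log (Real.log x)) * S x := by rw [hexp]; ring

/-- The archimedean factor `e^{(y-1) log D} Γ(y)^{-k}` of the predicted limit never vanishes for `y > 0`, so a
limit `Λ(y) ·` (factor) `= 0` forces `Λ(y) = 0`. [folklore] -/
theorem gammaFactor_ne_zero (k : ℕ) (D : ℝ) {y : ℝ} (hy : 0 < y) :
    Complex.exp (((y : ℂ) - 1) * (Real.log D : ℂ)) * (Complex.Gamma y)⁻¹ ^ k ≠ 0 := by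
  refine mul_ne_zero (Complex.exp_ne_zero _) (pow_ne_zero _ (inv_ne_zero ?_))
  exact Complex.Gamma_ne_zero_of_re_pos (by simpa using hy)

end Summit.Parity.BatemanHorn.Theorems.SystemLSDRealSegment.Negative
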